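import Literature.MathematicalPhysics.QuantumFieldTheory.Balaban1983to89.B9Eq325ProjFormulaTower
import Literature.MathematicalPhysics.QuantumFieldTheory.Balaban1983to89.B9Eq326WoodburySchur

/-!
# `Balaban1983to89.B9Eq326WoodburySchurTower` — T. Bałaban, *Propagators for lattice gauge theories in a background field*, Commun. Math. Phys. **99**
# (1985) 389–434 [Balaban1985BackgroundPropagators] (3.25) p. 394 *«Rf = (I − G′Q′*(Q′G′²Q′*)⁻¹Q′G′)f»*, (3.26) p. 395 *«Δ_a(U) = Δ(U) + D_U R(U) D*_U +
# Q*(U)aQ(U)»*, Thm 3.11 p. 416: **PRINT's `k`-LEVEL `G₁ = Δ_{a,k}(U)⁻¹` AROUND ITS LOCAL PART, IN WOODBURY FORM** — the tower twin of the OWNER's one-step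
# `B9Eq326WoodburySchur` §4: `Δ_{a,k}(U) = A₀,k − Uu∘c∘V` and `G₁,k = A₀,k⁻¹ + A₀,k⁻¹∘Uu∘(c + c∘V∘G₁,k∘Uu∘c)∘V∘A₀,k⁻¹` with `A₀,k = Δ(U) + D_UD*_U +
# Q_k(U)†(a•Q_k(U))`, `Uu = D_UG′_kQ̃′_k†`, `V = Q̃′_kG′_kD*_U`, `c = (Q̃′_kG′_k²Q̃′_k†)⁻¹` — the algebraic skeleton of beta-an4's INTERFACE REQUEST D4
# `exists_local_letter_G1k` (the sup row of `G₁,k` from the rows of `A₀,k⁻¹` (ne9-leaf-03 (ECL)), of `D_UG′_k`∕`G′_kD*_U` (OWNER g95), of `c` (OWNER storey D) and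
# the `L²` block decay of `G₁,k` ((FCLG)))

statement-level skeleton of published theorems with citation tags; proofs where landed; nothing here is a claim about the Yang–Mills mass gap

CITATION HEADER (lean-in-tree rule).  Audit cell `pub-balaban`, sub-cell `t4`, BINDER row NE9 (road ΔA-CT, leaf prover 03 `b2b-balaban-t4-ne9-formalise-leaf-03`
gen 78).  Imports ne9's `B9Eq325ProjFormulaTower` ((3.25) for `R_k(U)`: `QGGQk_pos`, `RofUk_eq_formula`; through it the OWNER's `B9Eq326OperatorTower`:
`laplaceAk`, `G1k`, `RofUk`, `QkW`, `QprimeTowerW`, and `B9Eq324DeltaPrimeATower`: `GpOfUk`) and the OWNER's `B9Eq326WoodburySchur` (`woodbury_of_inverse`,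
pure algebra).  Sources READ first-hand (`paper:balaban1985-cmp99-background-propagators`): p. 394 (3.21)–(3.25), p. 395 (3.26), p. 416 Thm 3.11.  The identity
is the Sherman–Morrison–Woodbury formula; print inverts `Δ_a` by the random walk of Sect. C instead — NOTHING of it is reproduced.

WHAT IS PROVED (sorry-free; proof lane — no `def`; [folklore] algebra BY NAME, every inverse a displayed letter).
* `laplaceAk_eq_local_sub` — `Δ_{a,k}(U) = A₀ − Uu∘c∘V` as linear maps (`RofUk_eq_formula` inserted in `D_UR_k(U)D*_U`; mutually adjoint transporters `hRS`).
* `G1k_eq_woodbury` — `G₁,k(U) = A₀⁻¹ + A₀⁻¹∘Uu∘(c + c∘V∘G₁,k(U)∘Uu∘c)∘V∘A₀⁻¹` (`A₀⁻¹ := greenK A₀ hpos₀`, positivity of the local part DISPLAYED — it is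
  free from Thm 3.11's by `B9Eq326LocalPartCoerciveTower.localK_pos_of_pos`).
HONEST SCOPE.  Algebra only; no row, no decay, no constant; NOT NE9 (cell pub-balaban: NE9 NOT PRINTED ∕ NOT PROVED; «NE9 ⇐ the named binders»; row WALLED
ON A MODEL (O-NE9-1; #5 UNRULED); spine PROVED 0∕9; rung (B)+1 on a finite T⁴ — NOT infinite volume, NOT mass gap, NOT BetaPertH, NOT Clay; HONEST DEPENDENCY:
continuum YM on T⁴ ⇐ BetaPertH ∧ nine spine estimates (0/9 proved); BetaPertH ⇐ (D1) ∧ (D4) ∧ CAP+tail; G-an2-4 gates asym, D1 and NE2/3/4).  NEW file; nothing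
modified.  Net new unproved facts: 0.
-/

noncomputable section

open scoped InnerProductSpace ComplexConjugate

namespace Literature.MathematicalPhysics.QuantumFieldTheory.Balaban1983to89.B9Eq326WoodburySchurTower

open B4Sect5Torus (TSite)
open B9SectCLatticeCarrier (Bond)
open B9Eq311L2Pairing (WL2)
open B7Prop1Explicit (U1 Wcx boxVec)
open B11Eq103H1Complex (SiteL2K BondL2K greenK comp_greenK greenK_comp covDerivL2K covDivL2K)
open B9Eq310HessianOperator (adTransportW hessOp)
open B9Eq315QTorus (perCfg cornerSite)
open B9Eq315QTower (towerP UlevOf)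
open B9Eq326OperatorTower (laplaceAk G1k RofUk QkW QprimeTowerW)
open B9Eq324DeltaPrimeATower (laplacePrimeAk GpOfUk)
open B9Eq325ProjFormulaTower (QGGQk_pos RofUk_eq_formula)
open B9Eq326WoodburySchur (woodbury_of_inverse)

variable {d : ℕ} (L : ℕ) [NeZero L] (m : Fin d → ℕ) [∀ i, NeZero (m i)] (n : ℕ)
  {𝔸 : Type*} [NormedRing 𝔸] [StarRing 𝔸] [NormedAlgebra ℂ 𝔸] [StarModule ℂ 𝔸] [CompleteSpace 𝔸] [NormOneClass 𝔸]
  {W : Type*} [NormedAddCommGroup W] [InnerProductSpace ℂ W] [FiniteDimensional ℂ W] (φ : W ≃ₗ[ℂ] 𝔸) (c₀ : ℝ) [Fact (0 < c₀)]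
  (η : ℝ) (U : Bond d (towerP L m (n + 1)) → 𝔸ˣ) (c₁ : ℝ) [Fact (0 < c₁)] (a' : ℝ) (τ : 𝔸 →ₗ[ℂ] ℂ)
  (hRS : ∀ (b : Bond d (towerP L m (n + 1))) (v u : W), ⟪adTransportW φ U b v, u⟫_ℂ = ⟪v, adTransportW φ (fun b => (U b)⁻¹) b u⟫_ℂ)
  (hpos' : ∀ x : SiteL2K ℂ d (towerP L m (n + 1)) c₀ W, x ≠ 0 → 0 < RCLike.re ⟪x, laplacePrimeAk L m n φ η U a' (c₁ := c₁) x⟫_ℂ)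
  (hL : 1 ≤ L) (α : ℕ → ℝ) (hα1 : ∀ j, α j ≤ 1 / 64)
  (hU1 : ∀ (j : ℕ) (x : B7Prop1Explicit.Site d) (k : Fin d), perCfg (towerP L m (j + 1)) (UlevOf L m (n + 1) U j) x k ∈ U1 𝔸)
  (hreg : ∀ (j : ℕ) (y : TSite d (towerP L m j)) (k : Fin d) (ρ' : Fin d → Fin L),
    ‖((Wcx L (perCfg (towerP L m (j + 1)) (UlevOf L m (n + 1) U j)) (cornerSite L y) k (boxVec L ρ') : 𝔸ˣ) : 𝔸) - 1‖ ≤ α j)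
  (a : ℝ)

include hRS in
/-- **(3.26) AT `n+1` LEVELS AROUND ITS LOCAL PART**, letters displayed: with `G′_k = GpOfUk` ((3.25), positivity `hpos′`), `Q̃′_k = QprimeTowerW` read into the
weight-`c₁` coarse carrier, `c = (Q̃′_kG′_k²Q̃′_k†)⁻¹ := greenK … (QGGQk_pos …)`, `D = D_U`, `D* = D*_U` at `η⁻¹`, and the LETTERS `A₀ = Δ(U) + DD* + Q_k†(a•Q_k)`,
`Uu = DG′_kQ̃′_k†`, `V = Q̃′_kG′_kD*`: `Δ_{a,k}(U) = A₀ − Uu∘c∘V` — (3.25) `R_k = I − G′_kQ̃′_k†cQ̃′_kG′_k` (`RofUk_eq_formula`) inserted in `DR_kD*`.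
[cite: Balaban1985BackgroundPropagators, (3.25)–(3.26) pp.394–395] -/
theorem laplaceAk_eq_local_sub
    (A₀ : BondL2K ℂ d (towerP L m (n + 1)) c₀ W →ₗ[ℂ] BondL2K ℂ d (towerP L m (n + 1)) c₀ W)
    (hA₀ : A₀ = hessOp φ η U τ + covDerivL2K ℂ c₀ ((η : ℂ))⁻¹ (adTransportW φ U) ∘ₗ covDivL2K ℂ c₀ ((η : ℂ))⁻¹ (adTransportW φ fun b => (U b)⁻¹) +
      LinearMap.adjoint (QkW L m n φ U hL α hα1 hU1 hreg (c₀ := c₀) (c₁ := c₁)) ∘ₗ ((a : ℂ) • QkW L m n φ U hL α hα1 hU1 hreg (c₀ := c₀) (c₁ := c₁)))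
    (Uu : SiteL2K ℂ d m c₁ W →ₗ[ℂ] BondL2K ℂ d (towerP L m (n + 1)) c₀ W)
    (hUu : Uu = covDerivL2K ℂ c₀ ((η : ℂ))⁻¹ (adTransportW φ U) ∘ₗ GpOfUk L m n φ η U a' (c₁ := c₁) hpos' ∘ₗ
      LinearMap.adjoint ((WL2.linearEquiv ℂ ℂ (fun _ : TSite d m => c₁)).symm.toLinearMap ∘ₗ QprimeTowerW L m n φ U (c₀ := c₀)))
    (V : BondL2K ℂ d (towerP L m (n + 1)) c₀ W →ₗ[ℂ] SiteL2K ℂ d m c₁ W)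
    (hV : V = ((WL2.linearEquiv ℂ ℂ (fun _ : TSite d m => c₁)).symm.toLinearMap ∘ₗ QprimeTowerW L m n φ U (c₀ := c₀)) ∘ₗ
      GpOfUk L m n φ η U a' (c₁ := c₁) hpos' ∘ₗ covDivL2K ℂ c₀ ((η : ℂ))⁻¹ (adTransportW φ fun b => (U b)⁻¹)) :
    laplaceAk L m n φ η U hL α hα1 hU1 hreg τ (c₀ := c₀) (c₁ := c₁) a =
      A₀ - Uu ∘ₗ greenK _ (QGGQk_pos L m n φ c₀ η U c₁ a' hRS hpos') ∘ₗ V := by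
  subst hA₀ hUu hV
  apply LinearMap.ext
  intro x
  have e1 : laplaceAk L m n φ η U hL α hα1 hU1 hreg τ (c₀ := c₀) (c₁ := c₁) a x =
      hessOp φ η U τ x + covDerivL2K ℂ c₀ ((η : ℂ))⁻¹ (adTransportW φ U)
        (RofUk L m n φ η U (c₀ := c₀) (covDivL2K ℂ c₀ ((η : ℂ))⁻¹ (adTransportW φ fun b => (U b)⁻¹) x)) +
        LinearMap.adjoint (QkW L m n φ U hL α hα1 hU1 hreg (c₀ := c₀) (c₁ := c₁)) ((a : ℂ) • QkW L m n φ U hL α hα1 hU1 hreg (c₀ := c₀) (c₁ := c₁) x) := rfl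
  rw [e1, RofUk_eq_formula L m n φ c₀ η U c₁ a' hRS hpos', map_sub]
  simp only [LinearMap.sub_apply, LinearMap.add_apply, LinearMap.comp_apply, LinearMap.smul_apply]
  abel

include hRS in
/-- **PRINT's `G₁,k(U)` IN WOODBURY FORM** (positivity `hpos` of `Δ_{a,k}(U)` = Thm 3.11 displayed; positivity `hpos₀` of the LOCAL part `A₀` displayed,
`A₀⁻¹ := greenK A₀ hpos₀`; letters `A₀`, `Uu`, `V` as in `laplaceAk_eq_local_sub`, `c = (Q̃′_kG′_k²Q̃′_k†)⁻¹`):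
`G₁,k(U) = A₀⁻¹ + A₀⁻¹∘Uu∘(c + c∘V∘G₁,k(U)∘Uu∘c)∘V∘A₀⁻¹` — `woodbury_of_inverse`; the bracket is the coarse core `S⁻¹` on the unit lattice.
[cite: Balaban1985BackgroundPropagators, (3.25)–(3.26) pp.394–395, Thm 3.11 p.416] -/
theorem G1k_eq_woodbury
    (A₀ : BondL2K ℂ d (towerP L m (n + 1)) c₀ W →ₗ[ℂ] BondL2K ℂ d (towerP L m (n + 1)) c₀ W)
    (hA₀ : A₀ = hessOp φ η U τ + covDerivL2K ℂ c₀ ((η : ℂ))⁻¹ (adTransportW φ U) ∘ₗ covDivL2K ℂ c₀ ((η : ℂ))⁻¹ (adTransportW φ fun b => (U b)⁻¹) +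
      LinearMap.adjoint (QkW L m n φ U hL α hα1 hU1 hreg (c₀ := c₀) (c₁ := c₁)) ∘ₗ ((a : ℂ) • QkW L m n φ U hL α hα1 hU1 hreg (c₀ := c₀) (c₁ := c₁)))
    (Uu : SiteL2K ℂ d m c₁ W →ₗ[ℂ] BondL2K ℂ d (towerP L m (n + 1)) c₀ W)
    (hUu : Uu = covDerivL2K ℂ c₀ ((η : ℂ))⁻¹ (adTransportW φ U) ∘ₗ GpOfUk L m n φ η U a' (c₁ := c₁) hpos' ∘ₗ
      LinearMap.adjoint ((WL2.linearEquiv ℂ ℂ (fun _ : TSite d m => c₁)).symm.toLinearMap ∘ₗ QprimeTowerW L m n φ U (c₀ := c₀)))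
    (V : BondL2K ℂ d (towerP L m (n + 1)) c₀ W →ₗ[ℂ] SiteL2K ℂ d m c₁ W)
    (hV : V = ((WL2.linearEquiv ℂ ℂ (fun _ : TSite d m => c₁)).symm.toLinearMap ∘ₗ QprimeTowerW L m n φ U (c₀ := c₀)) ∘ₗ
      GpOfUk L m n φ η U a' (c₁ := c₁) hpos' ∘ₗ covDivL2K ℂ c₀ ((η : ℂ))⁻¹ (adTransportW φ fun b => (U b)⁻¹))
    (hpos : ∀ x : BondL2K ℂ d (towerP L m (n + 1)) c₀ W, x ≠ 0 →
      0 < RCLike.re ⟪x, laplaceAk L m n φ η U hL α hα1 hU1 hreg τ (c₀ := c₀) (c₁ := c₁) a x⟫_ℂ)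
    (hpos₀ : ∀ x : BondL2K ℂ d (towerP L m (n + 1)) c₀ W, x ≠ 0 → 0 < RCLike.re ⟪x, A₀ x⟫_ℂ) :
    G1k L m n φ η U hL α hα1 hU1 hreg τ hpos =
      greenK A₀ hpos₀ + greenK A₀ hpos₀ ∘ₗ Uu ∘ₗ
        (greenK _ (QGGQk_pos L m n φ c₀ η U c₁ a' hRS hpos') +
          greenK _ (QGGQk_pos L m n φ c₀ η U c₁ a' hRS hpos') ∘ₗ V ∘ₗ G1k L m n φ η U hL α hα1 hU1 hreg τ hpos ∘ₗ Uu ∘ₗ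
            greenK _ (QGGQk_pos L m n φ c₀ η U c₁ a' hRS hpos')) ∘ₗ V ∘ₗ greenK A₀ hpos₀ := by
  have hsub := laplaceAk_eq_local_sub L m n φ c₀ η U c₁ a' τ hRS hpos' hL α hα1 hU1 hreg a A₀ hA₀ Uu hUu V hV
  -- `G₁,k(U)` is a two-sided inverse of `Δ_{a,k}(U) = A₀ − Uu∘c∘V`
  have hG : (laplaceAk L m n φ η U hL α hα1 hU1 hreg τ (c₀ := c₀) (c₁ := c₁) a) ∘ₗ G1k L m n φ η U hL α hα1 hU1 hreg τ hpos = LinearMap.id :=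
    comp_greenK hpos
  have hG' : G1k L m n φ η U hL α hα1 hU1 hreg τ hpos ∘ₗ (laplaceAk L m n φ η U hL α hα1 hU1 hreg τ (c₀ := c₀) (c₁ := c₁) a) = LinearMap.id :=
    greenK_comp hpos
  rw [hsub] at hG hG'
  exact woodbury_of_inverse A₀ _ (comp_greenK hpos₀) (greenK_comp hpos₀) Uu V (greenK _ (QGGQk_pos L m n φ c₀ η U c₁ a' hRS hpos')) _
    (greenK_comp (QGGQk_pos L m n φ c₀ η U c₁ a' hRS hpos')) (comp_greenK (QGGQk_pos L m n φ c₀ η U c₁ a' hRS hpos')) _ hG hG'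

end Literature.MathematicalPhysics.QuantumFieldTheory.Balaban1983to89.B9Eq326WoodburySchurTower

end
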